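import Summits.AtomisticToContinuum.BoseEinsteinCondensation.Theorems.BECCellInformationOneBodyEntropyBoundAeCoreOrAeZero

/-!
# Crux `OneBodyEntropyBound` — line `registered`, lead's stub `stub_denseCellBound`, part 1a:
# pointwise IMS identity for a one-body partition acting on particle `0`

Support file (`--supports stmt-AtomisticToContinuum-13440`, lead c2). Calculus of the localisation
`X ↦ χ(x₀) Ψ(X)` of an `(n+1)`-body wave function by a one-body `C¹` function of particle `0`, and the pointwise
IMS identity for a partition `χ² + η² = 1`: `|∇(χΨ)|² + |∇(ηΨ)|² = |∇Ψ|² + IMS` with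
`IMS = (|∇χ|² + |∇η|²)(x₀)|Ψ|²` (cross terms cancel since `χ∇χ + η∇η = 0`), together with the bound
`IMS ≤ 3G·1_B(x₀)|Ψ|²` when `|∇χ|² + |∇η|² ≤ G` and the gradients vanish off `B` (`kineticDensity_localize_add`,
`ims_le`). Used by the one-particle local energy bound (part 1b, `DenseCell.local_energy_bound`).
-/

noncomputable section

namespace Summit.AtomisticToContinuum.BoseEinsteinCondensation.Cruxes.OneBodyEntropyBound.Birth

namespace DenseCell

open MeasureTheory Filter Topology
open scoped ENNReal NNReal
open Literature.MathematicalPhysics.QuantumManyBody.BoseGas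

variable {n : ℕ} {L : ℝ}

/-! ### Calculus of the one-body localisation `X ↦ χ(x₀) Ψ(X)` -/

/-- The localised function `X ↦ χ(X 0) · ψ(X)` is `C¹`. [folklore] -/
theorem contDiff_localize {χ : Space → ℝ} (hχ : ContDiff ℝ 1 χ) {ψ : Config (n + 1) → ℂ}
    (hψ : ContDiff ℝ 1 ψ) : ContDiff ℝ 1 fun X : Config (n + 1) => (χ (X 0) : ℂ) * ψ X :=
  (Complex.ofRealCLM.contDiff.comp
    (hχ.comp (ContinuousLinearMap.proj (R := ℝ) (φ := fun _ : Fin (n + 1) => Space) 0).contDiff)).mul hψ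

/-- Derivative of the localised function: `∂_V(χ(x₀)ψ) = χ'(x₀)[V 0] ψ + χ(x₀) ∂_V ψ`. [folklore] -/
theorem fderiv_localize_apply {χ : Space → ℝ} (hχ : Differentiable ℝ χ) {ψ : Config (n + 1) → ℂ}
    (hψ : Differentiable ℝ ψ) (X V : Config (n + 1)) :
    fderiv ℝ (fun X : Config (n + 1) => (χ (X 0) : ℂ) * ψ X) X V =
      (fderiv ℝ χ (X 0) (V 0) : ℂ) * ψ X + (χ (X 0) : ℂ) * fderiv ℝ ψ X V := by
  have hp : HasFDerivAt (fun X : Config (n + 1) => X 0)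
      (ContinuousLinearMap.proj (R := ℝ) (φ := fun _ : Fin (n + 1) => Space) 0) X :=
    (ContinuousLinearMap.proj (R := ℝ) (φ := fun _ : Fin (n + 1) => Space) 0).hasFDerivAt
  have hg : HasFDerivAt (fun X : Config (n + 1) => (χ (X 0) : ℂ))
      (Complex.ofRealCLM.comp ((fderiv ℝ χ (X 0)).comp
        (ContinuousLinearMap.proj (R := ℝ) (φ := fun _ : Fin (n + 1) => Space) 0))) X := by
    have h1 : HasFDerivAt (fun X : Config (n + 1) => χ (X 0))
        ((fderiv ℝ χ (X 0)).comp
          (ContinuousLinearMap.proj (R := ℝ) (φ := fun _ : Fin (n + 1) => Space) 0)) X :=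
      (hχ (X 0)).hasFDerivAt.comp X hp
    exact Complex.ofRealCLM.hasFDerivAt.comp X h1
  have h : HasFDerivAt (fun X : Config (n + 1) => (χ (X 0) : ℂ) * ψ X) _ X := hg.mul (hψ X).hasFDerivAt
  rw [h.fderiv]
  simp only [add_apply, smul_apply,
    ContinuousLinearMap.coe_comp, Function.comp_apply, ContinuousLinearMap.proj_apply,
    Complex.ofRealCLM_apply, smul_eq_mul]
  ring

/-- The real inner-product expansion behind IMS: if `c² + c'² = 1` and `a c + a' c' = 0` then
`|a z + c w|² + |a' z + c' w|² = (a² + a'²)|z|² + |w|²`. [folklore] -/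
theorem normSq_localize_add {a a' c c' : ℝ} (hc : c ^ 2 + c' ^ 2 = 1) (hac : a * c + a' * c' = 0)
    (z w : ℂ) :
    ‖(a : ℂ) * z + (c : ℂ) * w‖ ^ 2 + ‖(a' : ℂ) * z + (c' : ℂ) * w‖ ^ 2 =
      (a ^ 2 + a' ^ 2) * ‖z‖ ^ 2 + ‖w‖ ^ 2 := by
  have e1 : ∀ (p q : ℝ), ‖(p : ℂ) * z + (q : ℂ) * w‖ ^ 2 =
      p ^ 2 * ‖z‖ ^ 2 + 2 * (p * q * inner ℝ z w) + q ^ 2 * ‖w‖ ^ 2 := by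
    intro p q
    have hz : (p : ℂ) * z = p • z := by rw [Complex.real_smul]
    have hw : (q : ℂ) * w = q • w := by rw [Complex.real_smul]
    rw [hz, hw, norm_add_sq_real, norm_smul, norm_smul, real_inner_smul_left, real_inner_smul_right,
      Real.norm_eq_abs, Real.norm_eq_abs, mul_pow, mul_pow, sq_abs, sq_abs]
    ring
  rw [e1, e1]
  have : a ^ 2 * ‖z‖ ^ 2 + 2 * (a * c * inner ℝ z w) + c ^ 2 * ‖w‖ ^ 2 +
      (a' ^ 2 * ‖z‖ ^ 2 + 2 * (a' * c' * inner ℝ z w) + c' ^ 2 * ‖w‖ ^ 2) =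
      (a ^ 2 + a' ^ 2) * ‖z‖ ^ 2 + 2 * ((a * c + a' * c') * inner ℝ z w) + (c ^ 2 + c' ^ 2) * ‖w‖ ^ 2 := by
    ring
  rw [this, hac, hc]
  ring

/-- `χ² + η² = 1` differentiated: `χ χ'[u] + η η'[u] = 0`. [folklore] -/
theorem fderiv_partition_cancel {χ η : Space → ℝ} (hχ : Differentiable ℝ χ) (hη : Differentiable ℝ η)
    (hχη : ∀ x, χ x ^ 2 + η x ^ 2 = 1) (x u : Space) :
    fderiv ℝ χ x u * χ x + fderiv ℝ η x u * η x = 0 := by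
  have h : HasFDerivAt (fun y => χ y * χ y + η y * η y)
      ((χ x • fderiv ℝ χ x + χ x • fderiv ℝ χ x) + (η x • fderiv ℝ η x + η x • fderiv ℝ η x)) x :=
    ((hχ x).hasFDerivAt.mul (hχ x).hasFDerivAt).add ((hη x).hasFDerivAt.mul (hη x).hasFDerivAt)
  have hconst : fderiv ℝ (fun y => χ y * χ y + η y * η y) x = 0 := by
    have : (fun y => χ y * χ y + η y * η y) = fun _ => (1 : ℝ) :=
      funext fun y => by rw [← sq, ← sq]; exact hχη y
    rw [this, fderiv_const_apply]
  have h0 := congrArg (fun T : Space →L[ℝ] ℝ => T u) (h.fderiv.symm.trans hconst)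
  simp only [add_apply, smul_apply, smul_eq_mul,
    zero_apply] at h0
  linarith

/-- `χ² + η² = 1` forces `|χ| ≤ 1`. [folklore] -/
theorem abs_le_one_of_partition {χ η : Space → ℝ} (hχη : ∀ x, χ x ^ 2 + η x ^ 2 = 1) (x : Space) :
    |χ x| ≤ 1 := by
  have h := hχη x
  exact (sq_le_one_iff_abs_le_one (χ x)).1 (by nlinarith [sq_nonneg (η x)])

/-- Where `χ = 1` the gradient of `χ` vanishes (`χ ≤ 1` everywhere, a maximum). [folklore] -/
theorem fderiv_eq_zero_of_eq_one {χ η : Space → ℝ} (hχη : ∀ x, χ x ^ 2 + η x ^ 2 = 1) {x : Space}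
    (hx : χ x = 1) : fderiv ℝ χ x = 0 := by
  refine IsLocalMax.fderiv_eq_zero (Filter.Eventually.of_forall fun y => ?_)
  rw [hx]
  exact (le_abs_self _).trans (abs_le_one_of_partition hχη y)

/-- `‖(c : ℂ) z‖₊² = c² ‖z‖₊²` in `ℝ≥0∞`, for every real `c`. [folklore] -/
theorem ennnorm_real_mul_sq (c : ℝ) (z : ℂ) :
    ((‖(c : ℂ) * z‖₊ : ℝ≥0∞)) ^ 2 = ENNReal.ofReal (c ^ 2) * (‖z‖₊ : ℝ≥0∞) ^ 2 := by
  rw [coe_nnnorm_pow_two_eq_ofReal, coe_nnnorm_pow_two_eq_ofReal, norm_mul, Complex.norm_real,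
    Real.norm_eq_abs, mul_pow, sq_abs, ENNReal.ofReal_mul (sq_nonneg _)]

/-! ### The pointwise IMS identity for the one-body partition acting on particle `0` -/

/-- IMS per direction `V`: `‖∂_V(χΨ)‖² + ‖∂_V(ηΨ)‖² = (χ'(x₀)[V 0]² + η'(x₀)[V 0]²)‖Ψ‖² + ‖∂_V Ψ‖²`. [folklore] -/
theorem normSq_fderiv_localize_add {χ η : Space → ℝ} (hχ : Differentiable ℝ χ) (hη : Differentiable ℝ η)
    (hχη : ∀ x, χ x ^ 2 + η x ^ 2 = 1) {ψ : Config (n + 1) → ℂ} (hψ : Differentiable ℝ ψ)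
    (X V : Config (n + 1)) :
    ‖fderiv ℝ (fun X : Config (n + 1) => (χ (X 0) : ℂ) * ψ X) X V‖ ^ 2 +
        ‖fderiv ℝ (fun X : Config (n + 1) => (η (X 0) : ℂ) * ψ X) X V‖ ^ 2 =
      ((fderiv ℝ χ (X 0) (V 0)) ^ 2 + (fderiv ℝ η (X 0) (V 0)) ^ 2) * ‖ψ X‖ ^ 2 +
        ‖fderiv ℝ ψ X V‖ ^ 2 := by
  rw [fderiv_localize_apply hχ hψ, fderiv_localize_apply hη hψ]
  exact normSq_localize_add (hχη (X 0)) (fderiv_partition_cancel hχ hη hχη (X 0) (V 0)) _ _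

/-- The same in `ℝ≥0∞`. [folklore] -/
theorem ennnormSq_fderiv_localize_add {χ η : Space → ℝ} (hχ : Differentiable ℝ χ)
    (hη : Differentiable ℝ η) (hχη : ∀ x, χ x ^ 2 + η x ^ 2 = 1) {ψ : Config (n + 1) → ℂ}
    (hψ : Differentiable ℝ ψ) (X V : Config (n + 1)) :
    (‖fderiv ℝ (fun X : Config (n + 1) => (χ (X 0) : ℂ) * ψ X) X V‖₊ : ℝ≥0∞) ^ 2 +
        (‖fderiv ℝ (fun X : Config (n + 1) => (η (X 0) : ℂ) * ψ X) X V‖₊ : ℝ≥0∞) ^ 2 =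
      ENNReal.ofReal (((fderiv ℝ χ (X 0) (V 0)) ^ 2 + (fderiv ℝ η (X 0) (V 0)) ^ 2) * ‖ψ X‖ ^ 2) +
        (‖fderiv ℝ ψ X V‖₊ : ℝ≥0∞) ^ 2 := by
  rw [coe_nnnorm_pow_two_eq_ofReal, coe_nnnorm_pow_two_eq_ofReal, coe_nnnorm_pow_two_eq_ofReal,
    ← ENNReal.ofReal_add (sq_nonneg _) (sq_nonneg _), normSq_fderiv_localize_add hχ hη hχη hψ,
    ENNReal.ofReal_add (by positivity) (sq_nonneg _)]

/-- **Pointwise IMS identity.** `|∇(χΨ)|² + |∇(ηΨ)|² = |∇Ψ|² + IMS`, where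
`IMS(X) = Σ_{i,k} (χ'(x₀)[e_{ik} 0]² + η'(x₀)[e_{ik} 0]²) |Ψ(X)|²` (only `i = 0` contributes). [folklore] -/
theorem kineticDensity_localize_add {χ η : Space → ℝ} (hχ : Differentiable ℝ χ)
    (hη : Differentiable ℝ η) (hχη : ∀ x, χ x ^ 2 + η x ^ 2 = 1) {ψ : Config (n + 1) → ℂ}
    (hψ : Differentiable ℝ ψ) (X : Config (n + 1)) :
    kineticDensity (fun X : Config (n + 1) => (χ (X 0) : ℂ) * ψ X) X +
        kineticDensity (fun X : Config (n + 1) => (η (X 0) : ℂ) * ψ X) X =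
      kineticDensity ψ X + ∑ i : Fin (n + 1), ∑ k : Fin 3, ENNReal.ofReal
        (((fderiv ℝ χ (X 0) ((Pi.single i (EuclideanSpace.single k (1 : ℝ)) : Config (n + 1)) 0)) ^ 2 +
          (fderiv ℝ η (X 0) ((Pi.single i (EuclideanSpace.single k (1 : ℝ)) : Config (n + 1)) 0)) ^ 2) *
          ‖ψ X‖ ^ 2) := by
  unfold kineticDensity
  rw [← Finset.sum_add_distrib, ← Finset.sum_add_distrib]
  refine Finset.sum_congr rfl fun i _ => ?_
  rw [← Finset.sum_add_distrib, ← Finset.sum_add_distrib]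
  refine Finset.sum_congr rfl fun k _ => ?_
  rw [ennnormSq_fderiv_localize_add hχ hη hχη hψ, add_comm]

/-- **Bound on the IMS density.** If `|χ'|² + |η'|² ≤ G` everywhere and `χ' = η' = 0` off `B`, then
`IMS(X) ≤ 3G · 1_B(x₀) |Ψ(X)|²`. [folklore] -/
theorem ims_le {χ η : Space → ℝ} {G : ℝ} (hG : ∀ x, ‖fderiv ℝ χ x‖ ^ 2 + ‖fderiv ℝ η x‖ ^ 2 ≤ G)
    {B : Set Space} (hB : ∀ x, x ∉ B → fderiv ℝ χ x = 0 ∧ fderiv ℝ η x = 0)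
    (ψ : Config (n + 1) → ℂ) (X : Config (n + 1)) :
    (∑ i : Fin (n + 1), ∑ k : Fin 3, ENNReal.ofReal
        (((fderiv ℝ χ (X 0) ((Pi.single i (EuclideanSpace.single k (1 : ℝ)) : Config (n + 1)) 0)) ^ 2 +
          (fderiv ℝ η (X 0) ((Pi.single i (EuclideanSpace.single k (1 : ℝ)) : Config (n + 1)) 0)) ^ 2) *
          ‖ψ X‖ ^ 2)) ≤
      ENNReal.ofReal (3 * G) * (B.indicator (fun _ => (1 : ℝ≥0∞)) (X 0) * (‖ψ X‖₊ : ℝ≥0∞) ^ 2) := by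
  -- only `i = 0` contributes
  rw [Fin.sum_univ_succ]
  have hsucc : ∑ i : Fin n, ∑ k : Fin 3, ENNReal.ofReal
      (((fderiv ℝ χ (X 0) ((Pi.single i.succ (EuclideanSpace.single k (1 : ℝ)) : Config (n + 1)) 0)) ^ 2 +
        (fderiv ℝ η (X 0) ((Pi.single i.succ (EuclideanSpace.single k (1 : ℝ)) : Config (n + 1)) 0)) ^ 2) *
        ‖ψ X‖ ^ 2) = 0 := by
    refine Finset.sum_eq_zero fun i _ => Finset.sum_eq_zero fun k _ => ?_
    rw [Pi.single_eq_of_ne (Fin.succ_ne_zero i).symm]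
    simp
  rw [hsucc, add_zero]
  simp only [Pi.single_eq_same]
  by_cases hX : X 0 ∈ B
  · rw [Set.indicator_of_mem hX, one_mul]
    have hG0 : 0 ≤ G := le_trans (by positivity) (hG (X 0))
    calc ∑ k : Fin 3, ENNReal.ofReal
          (((fderiv ℝ χ (X 0) (EuclideanSpace.single k (1 : ℝ))) ^ 2 +
            (fderiv ℝ η (X 0) (EuclideanSpace.single k (1 : ℝ))) ^ 2) * ‖ψ X‖ ^ 2)
        ≤ ∑ _k : Fin 3, ENNReal.ofReal (G * ‖ψ X‖ ^ 2) := by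
          refine Finset.sum_le_sum fun k _ => ENNReal.ofReal_le_ofReal ?_
          refine mul_le_mul_of_nonneg_right ?_ (sq_nonneg _)
          have h1 : |fderiv ℝ χ (X 0) (EuclideanSpace.single k (1 : ℝ))| ≤ ‖fderiv ℝ χ (X 0)‖ := by
            have := (fderiv ℝ χ (X 0)).le_opNorm (EuclideanSpace.single k (1 : ℝ))
            rw [EuclideanSpace.single, PiLp.norm_single, norm_one, mul_one, Real.norm_eq_abs] at this
            exact this
          have h2 : |fderiv ℝ η (X 0) (EuclideanSpace.single k (1 : ℝ))| ≤ ‖fderiv ℝ η (X 0)‖ := by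
            have := (fderiv ℝ η (X 0)).le_opNorm (EuclideanSpace.single k (1 : ℝ))
            rw [EuclideanSpace.single, PiLp.norm_single, norm_one, mul_one, Real.norm_eq_abs] at this
            exact this
          have h1' := sq_le_sq' (abs_le.1 h1).1 (abs_le.1 h1).2
          have h2' := sq_le_sq' (abs_le.1 h2).1 (abs_le.1 h2).2
          linarith [hG (X 0)]
      _ = ENNReal.ofReal (3 * G) * (‖ψ X‖₊ : ℝ≥0∞) ^ 2 := by
          rw [Finset.sum_const, Finset.card_univ, Fintype.card_fin, nsmul_eq_mul, Nat.cast_ofNat,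
            ENNReal.ofReal_mul hG0, coe_nnnorm_pow_two_eq_ofReal, ENNReal.ofReal_mul zero_le_three,
            ENNReal.ofReal_ofNat, mul_assoc]
  · obtain ⟨h1, h2⟩ := hB (X 0) hX
    rw [h1, h2]
    simp

end DenseCell

/-- **Registered helper stub `stub_imsIdentity`** (lead, for `stub_denseCellBound`): the pointwise IMS identity
`|∇(χΨ)|² + |∇(ηΨ)|² = |∇Ψ|² + IMS` for a one-body partition `χ² + η² = 1` acting on particle `0`. [folklore] -/
theorem stub_imsIdentity :
    ∀ (n : ℕ) (χ η : EuclideanSpace ℝ (Fin 3) → ℝ), Differentiable ℝ χ → Differentiable ℝ η →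
      (∀ x, χ x ^ 2 + η x ^ 2 = 1) →
      ∀ (ψ : Literature.MathematicalPhysics.QuantumManyBody.BoseGas.Config (n + 1) → ℂ), Differentiable ℝ ψ →
        ∀ X : Literature.MathematicalPhysics.QuantumManyBody.BoseGas.Config (n + 1),
          Literature.MathematicalPhysics.QuantumManyBody.BoseGas.kineticDensity
              (fun X : Literature.MathematicalPhysics.QuantumManyBody.BoseGas.Config (n + 1) => (χ (X 0) : ℂ) * ψ X) X +
            Literature.MathematicalPhysics.QuantumManyBody.BoseGas.kineticDensity
              (fun X : Literature.MathematicalPhysics.QuantumManyBody.BoseGas.Config (n + 1) => (η (X 0) : ℂ) * ψ X) X =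
          Literature.MathematicalPhysics.QuantumManyBody.BoseGas.kineticDensity ψ X +
            ∑ i : Fin (n + 1), ∑ k : Fin 3, ENNReal.ofReal
              (((fderiv ℝ χ (X 0) ((Pi.single i (EuclideanSpace.single k (1 : ℝ)) :
                  Literature.MathematicalPhysics.QuantumManyBody.BoseGas.Config (n + 1)) 0)) ^ 2 +
                (fderiv ℝ η (X 0) ((Pi.single i (EuclideanSpace.single k (1 : ℝ)) :
                  Literature.MathematicalPhysics.QuantumManyBody.BoseGas.Config (n + 1)) 0)) ^ 2) * ‖ψ X‖ ^ 2) :=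
  fun _ _ _ hχ hη hχη _ hψ X => DenseCell.kineticDensity_localize_add hχ hη hχη hψ X

end Summit.AtomisticToContinuum.BoseEinsteinCondensation.Cruxes.OneBodyEntropyBound.Birth

end
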